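import Mathlib
import Literature.NumberTheory.NumberFields.PureCubicGenusDivisorLemmas
import HarnessLib

/-!
# Genus theory for pure cubic fields with a general radicand: a prime divisor `ℓ ≡ 1 (mod 3)` forces `3 ∣ h`

Topic `NumberTheory/NumberFields`.  Theorem-only file (no definition, no named fact, D-0026),
unconditional; continuation of `PureCubicClassNumberModThreeProofs.lean`, whose Installment 2
(`Honda1971.three_dvd_classNumber_of_prime_mod_three`) proves the case of a radicand `m = pq`
(two distinct primes).  Here the radicand is an ARBITRARY natural number `m` and `ℓ ≡ 1 (mod 3)` is a
prime with `3 ∤ v_ℓ(m)` (e.g. `ℓ ∥ m`), i.e. `ℓ` divides the cube-free part of `m`: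

> T. Honda, *Pure cubic fields whose class numbers are multiples of three*, J. Number Theory 3
> (1971) 7–12, §1: if the cube-free radicand has a prime divisor `p ≡ 1 (mod 3)` then `3 ∣ h`;
> M. Ishida, *The genus fields of algebraic number fields*, LNM 555 (1976), Ch. 7, eq. (7.7):
> the genus number of `ℚ(ⁿ√a)` (`n` odd) is `∏_{p ∣ a, p ∤ n} (n, p − 1)`, so for `n = 3` every
> prime divisor `p ≡ 1 (mod 3)` of `a` contributes an unramified cyclic cubic extension
> `K·k_p / K` (`k_p` the cubic subfield of `ℚ(ζ_p)`), whence `3 ∣ h_K` by class field theory.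

The proof is the one of Installment 2 with the second prime `q` removed: the cubic subfield `C` of
`ℚ(ζ_ℓ)` gives the cyclic cubic extension `KC/K`, unramified at every finite prime (off `ℓ` because
`C` is unramified there; above `ℓ` because `ℓ` is tame in the Galois closure of `K·C`, whose
inertia groups are cyclic of order dividing `6`, while `e(ℓ, K) = 3`), and the tree's Artin map for
unramified cyclic extensions of odd degree (`dvd_classNumber_of_isUnramifiedIn_of_odd_prime_card`,
Cox Cor. 5.24) gives `3 ∣ h_K`; the irreducibility of `X³ − m` over `C` comes from
`Honda1971.pow_three_ne_natCast_of_isGalois` (no cube root of `m` in a Galois cubic field).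

* `Honda1971.three_dvd_classNumber_of_not_dvd_padicValNat` — **`ℓ ≡ 1 (mod 3)` prime,
  `3 ∤ v_ℓ(m)` ⟹ `3 ∣ h(K)` for every cubic number field `K ∋ ∛m`**;
* `Honda1971.three_dvd_classNumber_of_padicValNat_eq_one` — the case `ℓ ∥ m`.

## References

* T. Honda, *Pure cubic fields whose class numbers are multiples of three*, J. Number Theory 3
  (1971) 7–12, §1 and Theorem. [Honda1971]
* M. Ishida, *The genus fields of algebraic number fields*, Lecture Notes in Math. 555, Springer
  (1976), Ch. 7, Thm. 7 / eq. (7.7). [Ishida1976]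
* S. Aouissi, D. C. Mayer, M. C. Ismaili, M. Talbi, A. Azizi, *3-rank of ambiguous class groups of
  cubic Kummer extensions*, Period. Math. Hungar. 81 (2020), §2.3 eq. (2.3). [AouissiMayerIsmailiTalbiAzizi2020]
* D. A. Cox, *Primes of the form x² + ny²*, 2nd ed. (2013), §5.C Cor. 5.24. [Cox2013]
-/

noncomputable section

open Polynomial NumberField IsDedekindDomain
open scoped IntermediateField nonZeroDivisors

namespace Literature.NumberTheory.NumberFields

namespace Honda1971

/-! ### Genus theory: a prime factor `ℓ ≡ 1 (mod 3)` of the radicand forces `3 ∣ h` -/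

/-- **Genus theory for `ℚ(∛m)` with a general radicand (Honda 1971, §1; Ishida LNM 555, eq. (7.7)
at `n = 3`):** if `ℓ ≡ 1 (mod 3)` is a prime with `3 ∤ v_ℓ(m)` (i.e. `ℓ` divides the cube-free part
of `m`; e.g. `ℓ ∥ m`), then `3 ∣ h(K)` for every cubic number field `K ∋ ∛m`.  Proof: the cubic
subfield `C` of `ℚ(ζ_ℓ)` gives the cyclic cubic extension `KC/K`, unramified at every finite prime
(off `ℓ` because `C` is unramified there; above `ℓ` because `ℓ` is tame in the Galois closure
`N` of `K·C` — a splitting field of `(X³ − m)·g`, `g` the cubic period polynomial, all of whose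
automorphisms have order dividing `6` — so its inertia groups above `ℓ ∤ 6` are cyclic of order
`≤ 6 < 9 = 3 · e(ℓ, K)`); the tree's Artin map for unramified cyclic extensions of odd degree
(`dvd_classNumber_of_isUnramifiedIn_of_odd_prime_card`, Cox Cor. 5.24) then gives `3 ∣ h_K`.
[cite: Honda1971, §1 and Theorem] [cite: Ishida1976, Ch. 7 eq. (7.7)]
[cite: AouissiMayerIsmailiTalbiAzizi2020, §2.3 eq. (2.3)] -/
theorem three_dvd_classNumber_of_not_dvd_padicValNat {ℓ m : ℕ} (hℓ : ℓ.Prime) (hℓ1 : ℓ % 3 = 1)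
    (hm : ¬ 3 ∣ padicValNat ℓ m) (K : Type) [Field K] [NumberField K]
    (h3 : Module.finrank ℚ K = 3) {α : K} (hα : α ^ 3 = (m : K)) :
    3 ∣ classNumber K := by
  classical
  haveI : Fact ℓ.Prime := ⟨hℓ⟩
  haveI : NeZero ℓ := ⟨hℓ.ne_zero⟩
  haveI : IsCyclotomicExtension {ℓ} ℚ (CyclotomicField ℓ ℚ) :=
    CyclotomicField.isCyclotomicExtension ℓ ℚ
  have hℓ6 : ¬ ℓ ∣ 6 := by
    intro h
    have h23 : ℓ ∣ 2 * 3 := h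
    rcases (Nat.Prime.dvd_mul hℓ).mp h23 with h | h
    · have := (Nat.prime_dvd_prime_iff_eq hℓ Nat.prime_two).mp h
      omega
    · have := (Nat.prime_dvd_prime_iff_eq hℓ Nat.prime_three).mp h
      omega
  have hcube : ∀ b : ℚ, b ^ 3 ≠ (m : ℚ) := pow_three_ne_of_not_dvd_padicValNat hℓ hm
  -- (1) the cyclic cubic field `C ⊆ ℚ(ζ_ℓ)`, a generator `η`, `g = minpoly η`
  obtain ⟨C, hCgal, hC3⟩ := exists_intermediateField_finrank_eq_three hℓ1 (CyclotomicField ℓ ℚ)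
  haveI := hCgal
  obtain ⟨η, hη⟩ := Field.exists_primitive_element ℚ C
  have hηint : IsIntegral ℚ η := Algebra.IsIntegral.isIntegral η
  obtain ⟨g, hgdef⟩ : ∃ g : ℚ[X], g = minpoly ℚ η := ⟨_, rfl⟩
  have hgmonic : g.Monic := hgdef ▸ minpoly.monic hηint
  have hg0 : g ≠ 0 := hgmonic.ne_zero
  have hgdeg : g.natDegree = 3 := by
    rw [hgdef, ← IntermediateField.adjoin.finrank hηint, hη, IntermediateField.finrank_top', hC3]
  have hgsplitC : (g.map (algebraMap ℚ C)).Splits := hgdef ▸ Normal.splits inferInstance η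
  have hgη : aeval η g = 0 := hgdef ▸ minpoly.aeval ℚ η
  -- (2) the ambient Galois number field `M`, a splitting field of `(X³ - m) · g`
  obtain ⟨f₁, hf₁def⟩ : ∃ f₁ : ℚ[X], f₁ = X ^ 3 - Polynomial.C (m : ℚ) := ⟨_, rfl⟩
  have hf₁monic : f₁.Monic := hf₁def ▸ monic_X_pow_sub_C _ (by norm_num)
  have hf₁0 : f₁ ≠ 0 := hf₁monic.ne_zero
  have hf₁deg : f₁.natDegree = 3 := by rw [hf₁def, natDegree_X_pow_sub_C]
  obtain ⟨M, _instF, _instNF, _instG, _instS⟩ :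
      ∃ (M : Type) (_ : Field M) (_ : NumberField M) (_ : IsGalois ℚ M),
        IsSplittingField ℚ M (f₁ * g) := by
    obtain ⟨instA, hS, hFD, hNo⟩ : ∃ inst : Algebra ℚ (f₁ * g).SplittingField,
        @IsSplittingField ℚ (f₁ * g).SplittingField _ _ inst (f₁ * g) ∧
        @FiniteDimensional ℚ (f₁ * g).SplittingField _ _ inst.toModule ∧
        @Normal ℚ (f₁ * g).SplittingField _ _ inst :=
      ⟨_, Polynomial.IsSplittingField.splittingField (f₁ * g),
        IsSplittingField.finiteDimensional _ (f₁ * g), SplittingField.instNormal (f₁ * g)⟩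
    have hinst : instA = DivisionRing.toRatAlgebra := Subsingleton.elim _ _
    subst hinst
    haveI hN : NumberField (f₁ * g).SplittingField :=
      @NumberField.mk _ _ (SplittingField.instCharZero (f₁ * g)) hFD
    haveI hG : IsGalois ℚ (f₁ * g).SplittingField :=
      { to_isSeparable := inferInstance, to_normal := hNo }
    exact ⟨(f₁ * g).SplittingField, inferInstance, hN, hG, hS⟩
  have hsplit : ((f₁ * g).map (algebraMap ℚ M)).Splits := IsSplittingField.splits M (f₁ * g)
  have hmap0 : (f₁ * g).map (algebraMap ℚ M) ≠ 0 := map_ne_zero (mul_ne_zero hf₁0 hg0)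
  have hf₁split : (f₁.map (algebraMap ℚ M)).Splits :=
    hsplit.of_dvd hmap0 (Polynomial.map_dvd _ (dvd_mul_right f₁ g))
  have hgsplit : (g.map (algebraMap ℚ M)).Splits :=
    hsplit.of_dvd hmap0 (Polynomial.map_dvd _ (dvd_mul_left g f₁))
  -- every automorphism of `M` has order dividing `6`; hence `ℓ ∤ #Gal(M/ℚ)`
  have h6 : ∀ σ : M ≃ₐ[ℚ] M, σ ^ 6 = 1 := fun σ =>
    pow_six_eq_one_of_isSplittingField_mul hf₁deg.le hgdeg.le hf₁0 hg0 σ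
  have hℓG : ¬ ℓ ∣ Nat.card (M ≃ₐ[ℚ] M) := by
    intro hdvd
    obtain ⟨σ, hσ⟩ := exists_prime_orderOf_dvd_card' ℓ hdvd
    exact hℓ6 (hσ ▸ orderOf_dvd_of_pow_eq_one (h6 σ))
  -- (3) a root `β` of `X³ - m` in `M` and `K₁ = ℚ(β) ≅ K`
  have hdegf : (f₁.map (algebraMap ℚ M)).degree ≠ 0 := by
    rw [degree_map, degree_eq_natDegree hf₁0, hf₁deg]; norm_num
  obtain ⟨β, hβ⟩ := hf₁split.exists_eval_eq_zero hdegf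
  have hβ3 : β ^ 3 = (m : M) := by
    rw [eval_map_algebraMap, hf₁def] at hβ
    simp only [map_natCast, aeval_sub, map_pow, aeval_X] at hβ
    exact sub_eq_zero.mp hβ
  set K₁ : IntermediateField ℚ M := ℚ⟮β⟯ with hK₁def
  have hβint : IsIntegral ℚ β := .of_finite ℚ β
  have hminβ : minpoly ℚ β = f₁ := by
    rw [hf₁def]; exact minpoly_eq_of_not_dvd_padicValNat (K := M) hℓ hm hβ3
  have hK₁3 : Module.finrank ℚ K₁ = 3 := by
    rw [hK₁def, IntermediateField.adjoin.finrank hβint, hminβ, hf₁deg]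
  -- the cube root inside `K₁`
  set βK : K₁ := ⟨β, IntermediateField.mem_adjoin_simple_self ℚ β⟩ with hβKdef
  have hβK : βK ^ 3 = (m : K₁) := Subtype.ext (by push_cast [hβKdef]; exact_mod_cast hβ3)
  -- (4) `C₁ = ℚ(roots of g) ≅ C`: Galois cubic, unramified away from `ℓ`
  set C₁ : IntermediateField ℚ M := IntermediateField.adjoin ℚ (g.rootSet M) with hC₁def
  haveI hC₁split : IsSplittingField ℚ C₁ g :=
    IntermediateField.adjoin_rootSet_isSplittingField hgsplit
  haveI hCsplit : IsSplittingField ℚ C g := by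
    refine ⟨hgsplitC, ?_⟩
    rw [eq_top_iff, ← IntermediateField.top_toSubalgebra, ← hη,
      IntermediateField.adjoin_simple_toSubalgebra_of_isAlgebraic hηint.isAlgebraic]
    refine Algebra.adjoin_mono (Set.singleton_subset_iff.mpr ?_)
    rw [mem_rootSet_of_ne hg0]
    exact hgη
  let e₁ : C ≃ₐ[ℚ] C₁ :=
    (IsSplittingField.algEquiv C g).trans (IsSplittingField.algEquiv C₁ g).symm
  have hC₁3 : Module.finrank ℚ C₁ = 3 := by rw [← e₁.toLinearEquiv.finrank_eq, hC3]
  haveI hC₁gal : IsGalois ℚ C₁ := by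
    haveI : Normal ℚ C₁ := Normal.of_isSplittingField g
    exact { to_isSeparable := inferInstance, to_normal := inferInstance }
  have hC₁disc : ∀ {q : ℕ}, q.Prime → q ≠ ℓ → ¬ (q : ℤ) ∣ NumberField.discr C₁ := by
    intro q hq hqℓ
    rw [← NumberField.discr_eq_discr_of_algEquiv C e₁]
    exact not_dvd_discr_of_intermediateField_cyclotomic (CyclotomicField ℓ ℚ) C hq hqℓ
  -- unramified primes of `C₁` away from `ℓ`, read on `𝓞 M`
  have ha : ∀ (Q : Ideal (𝓞 M)) [Q.IsMaximal], (ℓ : 𝓞 M) ∉ Q →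
      Algebra.IsUnramifiedAt ℤ (Q.under (𝓞 C₁)) := by
    intro Q _ hℓQ
    have hQne : Q ≠ ⊥ := Ideal.IsMaximal.ne_bot_of_isIntegral_int Q
    haveI : Finite (𝓞 M ⧸ Q) := Ideal.finiteQuotientOfFreeOfNeBot Q hQne
    letI : Field (𝓞 M ⧸ Q) := Ideal.Quotient.field Q
    obtain ⟨q, hqchar⟩ := CharP.exists (𝓞 M ⧸ Q)
    haveI := hqchar
    have hqprime : q.Prime := CharP.char_is_prime (𝓞 M ⧸ Q) q
    have hqQ : (q : 𝓞 M) ∈ Q := by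
      rw [← Ideal.Quotient.eq_zero_iff_mem, map_natCast]
      exact CharP.cast_eq_zero (𝓞 M ⧸ Q) q
    have hqℓ : q ≠ ℓ := fun h => hℓQ (h ▸ hqQ)
    haveI : (Q.under (𝓞 C₁)).IsMaximal := Ideal.IsMaximal.under _ Q
    refine (NumberField.not_dvd_discr_iff_forall_mem C₁ (𝓞 C₁)
      (Nat.prime_iff_prime_int.mp hqprime)).mp (hC₁disc hqprime hqℓ) (Q.under (𝓞 C₁))
      inferInstance ?_
    rw [Ideal.under_def, Ideal.mem_comap, map_intCast, Int.cast_natCast]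
    exact hqQ
  -- (5) `E₂ = K₁(roots of g)`: Galois over `K₁`, `E₂ = K₁ C₁`, of degree `3`
  set E₂ : IntermediateField K₁ M := IntermediateField.adjoin K₁ (g.rootSet M) with hE₂def
  have hE : E₂.restrictScalars ℚ = K₁ ⊔ C₁ :=
    IntermediateField.restrictScalars_adjoin_eq_sup ℚ K₁ (g.rootSet M)
  have hrootK : (g.map (algebraMap ℚ K₁)).rootSet M = g.rootSet M := by
    simp only [rootSet, aroots_def, Polynomial.map_map, ← IsScalarTower.algebraMap_eq]
  haveI : IsSplittingField K₁ E₂ (g.map (algebraMap ℚ K₁)) := by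
    have hsK : ((g.map (algebraMap ℚ K₁)).map (algebraMap K₁ M)).Splits := by
      rwa [Polynomial.map_map, ← IsScalarTower.algebraMap_eq]
    have := IntermediateField.adjoin_rootSet_isSplittingField hsK
    rwa [hrootK] at this
  haveI : Normal K₁ E₂ := Normal.of_isSplittingField (g.map (algebraMap ℚ K₁))
  haveI : IsGalois K₁ E₂ := { to_isSeparable := inferInstance, to_normal := inferInstance }
  -- `X³ - m` has no root in the Galois cubic field `C₁`, hence is irreducible over `C₁`
  have hirrC : Irreducible (f₁.map (algebraMap ℚ C₁)) := by
    have hdeg : (f₁.map (algebraMap ℚ C₁)).natDegree = 3 := by rw [natDegree_map, hf₁deg]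
    have hne : f₁.map (algebraMap ℚ C₁) ≠ 0 := Polynomial.map_ne_zero hf₁0
    rw [irreducible_iff_roots_eq_zero_of_degree_le_three (by omega) (by omega),
      Multiset.eq_zero_iff_forall_notMem]
    intro γ hγ
    rw [mem_roots hne, IsRoot.def, eval_map_algebraMap] at hγ
    have hγ3 : γ ^ 3 = (m : C₁) := by
      rw [hf₁def] at hγ
      simp only [map_natCast, aeval_sub, map_pow, aeval_X] at hγ
      exact sub_eq_zero.mp hγ
    exact pow_three_ne_natCast_of_isGalois hC₁3 hcube γ hγ3
  -- (6) degrees: `[K₁C₁ : ℚ] = 9`, hence `[E₂ : K₁] = 3`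
  set E₃ : IntermediateField C₁ M := IntermediateField.adjoin C₁ {β} with hE₃def
  have hE' : E₃.restrictScalars ℚ = K₁ ⊔ C₁ :=
    (IntermediateField.restrictScalars_adjoin_eq_sup ℚ C₁ {β}).trans (sup_comm _ _)
  have hE₃3 : Module.finrank C₁ E₃ = 3 := by
    have hβintC : IsIntegral C₁ β := .of_finite C₁ β
    have hmin : minpoly C₁ β = f₁.map (algebraMap ℚ C₁) := by
      refine (minpoly.eq_of_irreducible_of_monic hirrC ?_ (hf₁monic.map _)).symm
      rw [aeval_map_algebraMap, ← hminβ]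
      exact minpoly.aeval ℚ β
    rw [hE₃def, IntermediateField.adjoin.finrank hβintC, hmin, natDegree_map, hf₁deg]
  have h9 : Module.finrank ℚ (E₃.restrictScalars ℚ) = 9 := by
    haveI : Module.Free C₁ E₃ := Module.Free.of_divisionRing C₁ E₃
    haveI : Module.Free ℚ C₁ := Module.Free.of_divisionRing ℚ C₁
    change Module.finrank ℚ E₃ = 9
    rw [← Module.finrank_mul_finrank ℚ C₁ E₃, hC₁3, hE₃3]
  have h9' : Module.finrank ℚ (E₂.restrictScalars ℚ) = 9 := by
    rw [← h9]
    exact (IntermediateField.equivOfEq (hE.trans hE'.symm)).toLinearEquiv.finrank_eq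
  have hE3 : Module.finrank K₁ E₂ = 3 := by
    haveI : Module.Free K₁ E₂ := Module.Free.of_divisionRing K₁ E₂
    haveI : Module.Free ℚ K₁ := Module.Free.of_divisionRing ℚ K₁
    have h := Module.finrank_mul_finrank ℚ K₁ E₂
    rw [hK₁3] at h
    change 3 * Module.finrank K₁ E₂ = Module.finrank ℚ (E₂.restrictScalars ℚ) at h
    rw [h9'] at h
    omega
  -- (7) above `ℓ`: `e(𝔔 | ℓ) = #I(𝔔) ≤ 6 < 9 = 3 e(𝔔 ∩ K₁ | ℓ)`
  have hb : ∀ (Q : Ideal (𝓞 M)) [Q.IsMaximal], (ℓ : 𝓞 M) ∈ Q →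
      Q.ramificationIdx ℤ < 3 * (Q.under (𝓞 K₁)).ramificationIdx ℤ := by
    intro Q _ hℓQ
    haveI : (Q.under (𝓞 K₁)).IsMaximal := Ideal.IsMaximal.under _ Q
    have hne : Q.under (𝓞 K₁) ≠ ⊥ := Ideal.IsMaximal.ne_bot_of_isIntegral_int _
    let v : HeightOneSpectrum (𝓞 K₁) :=
      ⟨Q.under (𝓞 K₁), Ideal.IsMaximal.isPrime inferInstance, hne⟩
    have hℓv : (ℓ : 𝓞 K₁) ∈ v.asIdeal := by
      change (ℓ : 𝓞 K₁) ∈ Q.under (𝓞 K₁)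
      rw [Ideal.under_def, Ideal.mem_comap, map_natCast]
      exact hℓQ
    have he3 : (Q.under (𝓞 K₁)).ramificationIdx ℤ = 3 :=
      ramificationIdx_eq_three_of_not_dvd_padicValNat hℓ hm hK₁3 hβK v hℓv
    have hI : Q.ramificationIdx ℤ ≤ 6 := by
      rw [← card_inertia_eq_ramificationIdx_int M (M ≃ₐ[ℚ] M) Q]
      haveI := isCyclic_inertia_of_not_dvd_card hℓ hℓG Q hℓQ
      obtain ⟨γ, hγ⟩ := IsCyclic.exists_ofOrder_eq_natCard (α := Q.inertia (M ≃ₐ[ℚ] M))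
      rw [← hγ]
      refine Nat.le_of_dvd (by norm_num) (orderOf_dvd_of_pow_eq_one (Subtype.ext ?_))
      rw [Subgroup.coe_pow, Subgroup.coe_one]
      exact h6 γ
    omega
  -- (8) `E₂/K₁` is an unramified cyclic cubic extension, so `3 ∣ h(K₁)`
  have hunr : ∀ v : HeightOneSpectrum (𝓞 K₁), Algebra.IsUnramifiedIn (𝓞 E₂) v.asIdeal :=
    isUnramifiedIn_compositum K₁ C₁ E₂ hE hE3 ha hb
  have hcard : Nat.card (E₂ ≃ₐ[K₁] E₂) = 3 := by rw [IsGalois.card_aut_eq_finrank, hE3]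
  have h3K₁ : 3 ∣ classNumber K₁ :=
    dvd_classNumber_of_isUnramifiedIn_of_odd_prime_card K₁ E₂ Nat.prime_three (by norm_num)
      hcard hunr
  -- (9) transport along `K ≃ ℚ(β) = K₁`
  have hαint : IsIntegral ℚ α := .of_finite ℚ α
  have hminα : minpoly ℚ α = f₁ := by
    rw [hf₁def]; exact minpoly_eq_of_not_dvd_padicValNat hℓ hm hα
  let e₂ : ℚ⟮α⟯ ≃ₐ[ℚ] K₁ :=
    (IntermediateField.adjoinRootEquivAdjoin ℚ hαint).symm.trans
      ((AdjoinRoot.algEquivOfEq ℚ _ _ (hminα.trans hminβ.symm)).trans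
        (IntermediateField.adjoinRootEquivAdjoin ℚ hβint))
  have htop : ℚ⟮α⟯ = ⊤ := adjoin_eq_top_of_not_dvd_padicValNat hℓ hm h3 hα
  let e₃ : K ≃ₐ[ℚ] ℚ⟮α⟯ :=
    IntermediateField.topEquiv.symm.trans (IntermediateField.equivOfEq htop.symm)
  rw [classNumber_eq_of_ringEquiv (e₃.trans e₂).toRingEquiv]
  exact h3K₁

/-- **The case `ℓ ∥ m`** (the shape used by the quantum-advantage line `JuntaLadder`): for a prime
`ℓ ≡ 1 (mod 3)` dividing `m` exactly once, `3 ∣ h(K)` for every cubic number field `K ∋ ∛m`.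
[cite: Honda1971, §1 and Theorem] [cite: Ishida1976, Ch. 7 eq. (7.7)] -/
theorem three_dvd_classNumber_of_padicValNat_eq_one {ℓ m : ℕ} (hℓ : ℓ.Prime) (hℓ1 : ℓ % 3 = 1)
    (hm : padicValNat ℓ m = 1) (K : Type) [Field K] [NumberField K]
    (h3 : Module.finrank ℚ K = 3) (α : K) (hα : α ^ 3 = (m : K)) :
    3 ∣ classNumber K :=
  three_dvd_classNumber_of_not_dvd_padicValNat hℓ hℓ1 (by rw [hm]; decide) K h3 hα

end Honda1971

end Literature.NumberTheory.NumberFields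

end
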